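import Summits.Schanuel.Schanuel.Theorems.ZilberEacBranchKernel
import Summits.Schanuel.Schanuel.Theorems.ZilberEacAlgebraicLogRelation
import Summits.Schanuel.Schanuel.Theorems.ZilberEacLogDerivResidue
import Summits.Schanuel.Schanuel.Theorems.ZilberEacGrowthDensity
import Mathlib.Algebra.Polynomial.Reverse
import HarnessLib

/-!
# The equimodular class, XLIII: the logarithm of an algebraic branch with an unramified zero or
# pole is TRANSCENDENTAL over `ℂ(z)` — any degree

HONEST FRAMING.  Cell `pub-schanuel` (Zilber's Exponential-Algebraic Closedness, case ladder;
host summit Schanuel), seat 2, gen 25.  **`not_isAlgebraic_log_algebraicBranch_zero`** /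
**`not_isAlgebraic_log_algebraicBranch_pole`**: let `Q ∈ ℂ[s][t]` be irreducible of positive
`t`-degree `r`, let `ρ, L` be analytic at `z₀` with `ρ(z₀) ≠ 0`, `Q(z, ρ z) = 0` and `L' = ρ'/ρ`
near `z₀`, and suppose there is a point `a` with `q₀(a) = 0 ≠ q₁(a)` (an unramified ZERO of some
branch of `Q = 0`) or — when `q₀ ≠ 0` — with `q_r(a) = 0 ≠ q_{r-1}(a)` (an unramified POLE).  Then the
germ of `L` at `z₀` is NOT algebraic over `ℂ[zGerm]`.  Proof: file XLI gives `F, G, M ≥ 1` with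
`G(z, ρ z) ≢ 0` and `R(z, ρ z) ≡ 0` near `z₀` for an explicit `R ∈ ℂ[s][t]`; by file XL, `Q ∣ R` and
`Q ∤ G`; so along the analytic branch `η` through `(a, 0)` (file XLII) `R(z, η z) ≡ 0`,
`G(z, η z) ≢ 0`, and unwinding `R` with the chain rule gives `(F(z,η)/G(z,η))' = -M·η'/η` on a
punctured neighbourhood of `a` — impossible by the residue obstruction of file XLII.  The pole
case is the zero case for the reversed polynomial `t^r Q(s, 1/t)`, the branch `1/ρ` and `-L`.
This is the classical fact "the logarithm of a non-constant algebraic function is transcendental"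
(Liouville; cf. the valuation argument in Rosenlicht's exposition of Liouville's theorem) in the
generality the reciprocal-type fibres of `y₀`-degree `≥ 3` need (files XLIV–XLV); the hypothesis
"unramified zero or pole" replaces general Puiseux expansions, which the tree does not have.
[folklore, made concrete] (new in this form); nothing here is specific to Schanuel's conjecture
(neither used nor implied); Mantova–Masser's question (PLMS 2024 §1 p. 5) and EC(3,2) stay OPEN.
-/

noncomputable section

open Filter Topology Polynomial

set_option linter.dupNamespace false

namespace Summit.Schanuel.Schanuel.Theorems

/-! ## Part A. Reversal preserves irreducibility -/

/-- **The reversed polynomial of an irreducible polynomial with nonzero constant term is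
irreducible** (over a domain).  (`reverse ∘ reverse = id` on polynomials with nonzero constant term
is the tree's `Literature.NumberTheory.LFunctions.WeilFatou.reverse_reverse_of_coeff_zero_ne_zero`;
it is re-derived inline in three lines to keep this file's imports light.) [folklore] -/
theorem irreducible_reverse {R : Type*} [CommRing R] [IsDomain R] {Q : R[X]} (hQ : Irreducible Q)
    (h0 : Q.coeff 0 ≠ 0) : Irreducible Q.reverse := by
  have hQ0 : Q ≠ 0 := hQ.ne_zero
  have reverse_reverse_of_coeff_zero_ne_zero : ∀ {p : R[X]}, p.coeff 0 ≠ 0 → p.reverse.reverse = p := by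
    intro p hp
    have hd : p.reverse.natDegree = p.natDegree := by
      rw [Polynomial.reverse_natDegree, Polynomial.natTrailingDegree_eq_zero_of_constantCoeff_ne_zero hp,
        Nat.sub_zero]
    rw [Polynomial.reverse, hd, Polynomial.reverse, Polynomial.reflect_reflect]
  refine ⟨fun hu => ?_, fun A B hAB => ?_⟩
  · obtain ⟨r, hr, hrQ⟩ := Polynomial.isUnit_iff.1 hu
    apply hQ.not_isUnit
    have : Q = Polynomial.C r := by
      rw [← reverse_reverse_of_coeff_zero_ne_zero h0, ← hrQ, Polynomial.reverse_C]
    rw [this]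
    exact Polynomial.isUnit_C.2 hr
  · have hQrev : Q = A.reverse * B.reverse := by
      rw [← reverse_reverse_of_coeff_zero_ne_zero h0, hAB, Polynomial.reverse_mul_of_domain]
    have hAB0 : A.coeff 0 * B.coeff 0 ≠ 0 := by
      rw [← Polynomial.mul_coeff_zero, ← hAB, Polynomial.coeff_zero_reverse]
      exact Polynomial.leadingCoeff_ne_zero.2 hQ0
    have hA0 : A.coeff 0 ≠ 0 := left_ne_zero_of_mul hAB0
    have hB0 : B.coeff 0 ≠ 0 := right_ne_zero_of_mul hAB0
    have key : ∀ P : R[X], P.coeff 0 ≠ 0 → IsUnit P.reverse → IsUnit P := by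
      intro P hP hu
      obtain ⟨r, hr, hrP⟩ := Polynomial.isUnit_iff.1 hu
      have : P = Polynomial.C r := by
        rw [← reverse_reverse_of_coeff_zero_ne_zero hP, ← hrP, Polynomial.reverse_C]
      rw [this]
      exact Polynomial.isUnit_C.2 hr
    rcases hQ.isUnit_or_isUnit hQrev with h | h
    · exact Or.inl (key A hA0 h)
    · exact Or.inr (key B hB0 h)

/-! ## Part B. The zero case -/

/-- **The logarithm of an algebraic branch is transcendental — unramified-zero form.**  See the
module docstring. [folklore (Liouville), made concrete] (new in this form) -/
theorem not_isAlgebraic_log_algebraicBranch_zero {z₀ : ℂ} (Q : ℂ[X][X]) (hQirr : Irreducible Q)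
    (hQ1 : Q.natDegree ≠ 0) {a : ℂ} (ha : (Q.coeff 0).IsRoot a) (ha' : ¬ (Q.coeff 1).IsRoot a)
    {ρ L : ℂ → ℂ} (hρan : AnalyticAt ℂ ρ z₀) (hLan : AnalyticAt ℂ L z₀) (hρ0 : ρ z₀ ≠ 0)
    (hQρ : ∀ᶠ z in 𝓝 z₀, (Q.map (Polynomial.evalRingHom z)).eval (ρ z) = 0)
    (hL : ∀ᶠ z in 𝓝 z₀, HasDerivAt L (deriv ρ z / ρ z) z)
    (hLalg : IsAlgebraic (Algebra.adjoin ℂ ({zGerm z₀} : Set (AGerm z₀))) (AGerm.mk z₀ hLan)) :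
    False := by
  classical
  obtain ⟨H, hH0, hH⟩ := exists_polyPoly_relation hLalg
  obtain ⟨F, G, M, hM1, hG0, hR⟩ := exists_logRelation_of_algebraic Q hρan hLan hρ0 hQρ hL hH0 hH
  set R : ℂ[X][X] := G * (Polynomial.X * (coeffDeriv F * derivative Q - derivative F * coeffDeriv Q) -
      Polynomial.C (Polynomial.C (M : ℂ)) * coeffDeriv Q * G) -
    Polynomial.X * (coeffDeriv G * derivative Q - derivative G * coeffDeriv Q) * F with hRdef
  have hQO : germEval₂ z₀ (AGerm.mk z₀ hρan) Q = 0 := (germEval₂_mk_eq_zero_iff hρan Q).2 hQρ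
  have hQR : Q ∣ R := dvd_of_germEval₂_eq_zero _ hQirr hQ1 hQO hR
  have hQG : ¬ Q ∣ G := by
    rintro ⟨S, hS⟩
    apply hG0
    rw [hS, map_mul, hQO, zero_mul]
  -- the branch through `(a, 0)`
  obtain ⟨η, hηan, hηa, hQη⟩ := exists_zeroBranch Q ha ha'
  have hη0 : ¬ ∀ᶠ z in 𝓝 a, η z = 0 := by
    intro hz
    have hX : ∀ᶠ z in 𝓝 a, ((Polynomial.X : ℂ[X][X]).map (Polynomial.evalRingHom z)).eval (η z) = 0 := by
      filter_upwards [hz] with z hz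
      rw [Polynomial.map_X, Polynomial.eval_X, hz]
    obtain ⟨S, hS⟩ := (evalPP_eventually_eq_zero_iff_dvd hηan hQirr hQ1 hQη _).1 hX
    have h0 : (Q.map (Polynomial.evalRingHom z₀)).eval (ρ z₀) = 0 := hQρ.self_of_nhds
    have : ((Polynomial.X : ℂ[X][X]).map (Polynomial.evalRingHom z₀)).eval (ρ z₀) = 0 := by
      rw [hS, Polynomial.map_mul, Polynomial.eval_mul, h0, zero_mul]
    rw [Polynomial.map_X, Polynomial.eval_X] at this
    exact hρ0 this
  -- `f = F(z, η)`, `g = G(z, η) ≢ 0`, `e = ∂_tQ(z, η) ≠ 0`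
  have hfan : AnalyticAt ℂ (fun z => (F.map (Polynomial.evalRingHom z)).eval (η z)) a :=
    analyticAt_evalPP hηan F
  have hgan : AnalyticAt ℂ (fun z => (G.map (Polynomial.evalRingHom z)).eval (η z)) a :=
    analyticAt_evalPP hηan G
  have hg0 : ¬ ∀ᶠ z in 𝓝 a, (G.map (Polynomial.evalRingHom z)).eval (η z) = 0 := fun h =>
    hQG ((evalPP_eventually_eq_zero_iff_dvd hηan hQirr hQ1 hQη G).1 h)
  have hRη : ∀ᶠ z in 𝓝 a, (R.map (Polynomial.evalRingHom z)).eval (η z) = 0 :=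
    (evalPP_eventually_eq_zero_iff_dvd hηan hQirr hQ1 hQη R).2 hQR
  have hean : AnalyticAt ℂ (fun z => ((derivative Q).map (Polynomial.evalRingHom z)).eval (η z)) a :=
    analyticAt_evalPP hηan _
  have hea : ((derivative Q).map (Polynomial.evalRingHom a)).eval (η a) ≠ 0 := by
    rw [hηa, ← Polynomial.coeff_zero_eq_eval_zero, Polynomial.coeff_map, Polynomial.coeff_derivative,
      Polynomial.coe_evalRingHom]
    simpa using ha'
  have hene : ∀ᶠ z in 𝓝 a, ((derivative Q).map (Polynomial.evalRingHom z)).eval (η z) ≠ 0 :=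
    hean.continuousAt.eventually_ne hea
  have hηne : ∀ᶠ z in 𝓝[≠] a, η z ≠ 0 :=
    hηan.eventually_eq_zero_or_eventually_ne_zero.resolve_left hη0
  have hgne : ∀ᶠ z in 𝓝[≠] a, (G.map (Polynomial.evalRingHom z)).eval (η z) ≠ 0 :=
    hgan.eventually_eq_zero_or_eventually_ne_zero.resolve_left hg0
  -- the derivative of `f/g` on the punctured neighbourhood is `-M η'/η`
  have hderiv : ∀ᶠ z in 𝓝[≠] a, HasDerivAt
      (fun w => (F.map (Polynomial.evalRingHom w)).eval (η w) / (G.map (Polynomial.evalRingHom w)).eval (η w))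
      (-(M : ℂ) * (deriv η z / η z)) z := by
    filter_upwards [hηne, hgne, nhdsWithin_le_nhds hene, nhdsWithin_le_nhds hRη,
      nhdsWithin_le_nhds (eventually_eventually_nhds.2 hQη),
      nhdsWithin_le_nhds hηan.eventually_analyticAt] with z hηz hgz hez hRz hQz hηz_an
    have hη' : HasDerivAt η (deriv η z) z := hηz_an.differentiableAt.hasDerivAt
    have hQd := hasDerivAt_evalPP hη' Q
    have hQ0 : (fun y => (Q.map (Polynomial.evalRingHom y)).eval (η y)) =ᶠ[𝓝 z] fun _ => (0 : ℂ) := hQz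
    have hQs := hQd.unique ((hasDerivAt_const z (0 : ℂ)).congr_of_eventuallyEq hQ0)
    have hF' := hasDerivAt_evalPP hη' F
    have hG' := hasDerivAt_evalPP hη' G
    refine (hF'.div hG' hgz).congr_deriv ?_
    simp only [hRdef, Polynomial.map_sub, Polynomial.map_mul, Polynomial.eval_sub, Polynomial.eval_mul,
      Polynomial.map_X, Polynomial.eval_X, Polynomial.map_C, Polynomial.eval_C, Polynomial.coe_evalRingHom]
      at hRz
    -- abbreviations
    set y := η z
    set η' := deriv η z
    set f := (F.map (Polynomial.evalRingHom z)).eval y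
    set g := (G.map (Polynomial.evalRingHom z)).eval y
    set Fs := ((coeffDeriv F).map (Polynomial.evalRingHom z)).eval y
    set Ft := ((derivative F).map (Polynomial.evalRingHom z)).eval y
    set Gs := ((coeffDeriv G).map (Polynomial.evalRingHom z)).eval y
    set Gt := ((derivative G).map (Polynomial.evalRingHom z)).eval y
    set Qs := ((coeffDeriv Q).map (Polynomial.evalRingHom z)).eval y
    set Qt := ((derivative Q).map (Polynomial.evalRingHom z)).eval y
    have key : y * ((Fs + Ft * η') * g - f * (Gs + Gt * η')) + (M : ℂ) * η' * g ^ 2 = 0 := by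
      have h1 : Qt * (y * ((Fs + Ft * η') * g - f * (Gs + Gt * η')) + (M : ℂ) * η' * g ^ 2) = 0 := by
        linear_combination hRz + (y * (Ft * g - f * Gt) + (M : ℂ) * g ^ 2) * hQs
      exact (mul_eq_zero.1 h1).resolve_left hez
    field_simp
    linear_combination key
  exact no_quotient_primitive_of_logDeriv hfan hgan hg0 hηan hηa hη0
    (neg_ne_zero.2 (Nat.cast_ne_zero.2 (by omega))) hderiv

/-! ## Part C. The pole case, by reversal -/

/-- **The logarithm of an algebraic branch is transcendental — unramified-pole form.**  See the
module docstring. [folklore (Liouville), made concrete] (new in this form) -/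
theorem not_isAlgebraic_log_algebraicBranch_pole {z₀ : ℂ} (Q : ℂ[X][X]) (hQirr : Irreducible Q)
    (hQ1 : Q.natDegree ≠ 0) (hQ00 : Q.coeff 0 ≠ 0) {a : ℂ} (ha : (Q.coeff Q.natDegree).IsRoot a)
    (ha' : ¬ (Q.coeff (Q.natDegree - 1)).IsRoot a)
    {ρ L : ℂ → ℂ} (hρan : AnalyticAt ℂ ρ z₀) (hLan : AnalyticAt ℂ L z₀) (hρ0 : ρ z₀ ≠ 0)
    (hQρ : ∀ᶠ z in 𝓝 z₀, (Q.map (Polynomial.evalRingHom z)).eval (ρ z) = 0)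
    (hL : ∀ᶠ z in 𝓝 z₀, HasDerivAt L (deriv ρ z / ρ z) z)
    (hLalg : IsAlgebraic (Algebra.adjoin ℂ ({zGerm z₀} : Set (AGerm z₀))) (AGerm.mk z₀ hLan)) :
    False := by
  classical
  have hN : Q.reverse.natDegree = Q.natDegree := by
    rw [Polynomial.reverse_natDegree, Polynomial.natTrailingDegree_eq_zero_of_constantCoeff_ne_zero hQ00,
      Nat.sub_zero]
  have hirr' : Irreducible Q.reverse := irreducible_reverse hQirr hQ00
  have h0' : (Q.reverse.coeff 0).IsRoot a := by
    rw [Polynomial.coeff_zero_reverse]; exact ha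
  have h1' : ¬ (Q.reverse.coeff 1).IsRoot a := by
    rw [Polynomial.coeff_one_reverse, Polynomial.nextCoeff_of_natDegree_pos (Nat.pos_of_ne_zero hQ1)]
    exact ha'
  have hρne : ∀ᶠ z in 𝓝 z₀, ρ z ≠ 0 := hρan.continuousAt.eventually_ne hρ0
  have hρ'an : AnalyticAt ℂ (fun z => (ρ z)⁻¹) z₀ := hρan.inv hρ0
  have hQ'ρ : ∀ᶠ z in 𝓝 z₀, (Q.reverse.map (Polynomial.evalRingHom z)).eval ((ρ z)⁻¹) = 0 := by
    filter_upwards [hQρ, hρne] with z hz hρz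
    haveI := invertibleOfNonzero hρz
    have h := Polynomial.eval₂_reverse_mul_pow (Polynomial.evalRingHom z) (ρ z) Q
    rw [Polynomial.eval_map] at hz ⊢
    rw [hz, mul_eq_zero, invOf_eq_inv] at h
    exact h.resolve_right (pow_ne_zero _ hρz)
  have hL' : ∀ᶠ z in 𝓝 z₀, HasDerivAt (fun w => -L w) (deriv (fun w => (ρ w)⁻¹) z / (ρ z)⁻¹) z := by
    filter_upwards [hL, hρne, hρan.eventually_analyticAt] with z hLz hρz hρaz
    have hinv : HasDerivAt (fun w => (ρ w)⁻¹) (-(deriv ρ z) / (ρ z) ^ 2) z :=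
      (hρaz.differentiableAt.hasDerivAt).inv hρz
    have hval : -(deriv ρ z) / ρ z ^ 2 / (ρ z)⁻¹ = -(deriv ρ z / ρ z) := by
      rw [div_inv_eq_mul]
      field_simp
    rw [hinv.deriv, hval]
    exact hLz.neg
  have hLalg' : IsAlgebraic (Algebra.adjoin ℂ ({zGerm z₀} : Set (AGerm z₀))) (AGerm.mk z₀ hLan.neg) := by
    rw [AGerm.mk_neg]; exact hLalg.neg
  exact not_isAlgebraic_log_algebraicBranch_zero Q.reverse hirr' (by rw [hN]; exact hQ1) h0' h1' hρ'an
    hLan.neg (inv_ne_zero hρ0) hQ'ρ hL' hLalg'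

end Summit.Schanuel.Schanuel.Theorems
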